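import Literature.NumberTheory.Rogawski1990.FinExplicitTransferFactorLeviStratum   -- ★ Levi stratum bookkeeping: `eval_finCharpolyTwo_eq_of_endoEmbLocal_eq`, `finGammaTwo_eq_of_endoEmbLocal_eq`
import HarnessLib

/-!
# R90 · S6 «Ch. 14.1–14.5 stable trace formula» — WAVE 7 card W7-d, helper file: the DISCRIMINANT EXPONENT on the whole diagonal torus,
# `log v_w χ_g(u)_w = log v_w(d₀,w) + 2·log v_w((a − 1)_w)` (`Theorems/R90S6DiagWeylExponent.lean`)

Cell `hodgecm-mathlib`, crux H413 (`stmt-HodgeConjecture-24833`), route of record `HCCMUnconditional`; programme R90-TF, section S6 (base `R90-C14`),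
seat R90-C14-p05 (g0); S6 dealer R90-C14-plan (g2) 23:18:29Z «then W7-d `transferFactor_diag_value` (E1.3.6.1)» (menu `R90/R90-szE1.1/g3/CLOSURE-E1.1.md` §3
row W7-d d06fc743cc0ccbd9); house rule (2) «a reusable helper gets its own file»: this is the integrality-free exponent bookkeeping consumed by the W7-d head
`Theorems/R90S6TransferFactorDiag.lean` (and reusable by the E1.3.6.2 constant-term row).  Helper lane `--supports stmt-HodgeConjecture-24833 --as helper`;
ONE theorem (no definition, no instance, no notation, no named fact, no `sorry`); imports = ★ `Literature.NumberTheory.Rogawski1990.FinExplicitTransferFactorLeviStratum`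
+ HarnessLib.

THE MATHEMATICS [Rogawski1990, §4.9 p. 55].  `v` a finite place of `L⁺` non-split in the CM field `L` (`c • w = w`), `γ_H ∈ H_v` with `ι_v(γ_H) = diag(d₀, d₁, d₂)`
on the diagonal torus of `U(Φ₃)(L⁺_v)` (`σ(d₂)d₀ = σ(d₁)d₁ = σ(d₀)d₂ = 1`), `a = d₀⁻¹d₁` with `a − 1 ∈ (∏_{w∣v} L_w)^×`.  Then `χ_g(u) = (d₁ − d₀)(d₁ − d₂)
= −d₀d₁(a − 1)σ(a − 1)` (★ `HeisRing.weylNumerator_eq`), `v_w(d₁,w) = 1` (★ `valued_finGammaTwo_apply_eq_one`, from `σ(d₁)d₁ = 1`) and `v_w ∘ σ_w = v_w`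
(★ `valued_galAdicCompletionMap`), so `log v_w χ_g(u)_w = log v_w(d₀,w) + 2·log v_w((a − 1)_w)` — the integrality-free form of ★
`log_valued_eval_finCharpolyTwo_eq_two_mul` (there `ι_v(γ_H) ∈ K₃` kills the `d₀` term): print's exponent `n₁₂ + n₂₃` has the parity of `−ord_w d₀`.
HONEST LABEL: local bookkeeping for the E1-c hyperbolic half E1.3.6; count-neutral; HC_CM is proved only modulo the 7 printed citations (2 remaining named
inputs: hLiu418 = stmt-HodgeConjecture-24832, h413 = stmt-HodgeConjecture-24833) until rung 0 closes.
-/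

set_option autoImplicit false
-- the mandated namespace repeats the single-problem summit's segment (`HodgeConjecture.HodgeConjecture`)
set_option linter.dupNamespace false

noncomputable section

open NumberField IsDedekindDomain Matrix Polynomial
open scoped NNReal Matrix MatrixGroups
open Literature.NumberTheory.Automorphic Literature.NumberTheory.Automorphic.UnitaryGroup
open Literature.NumberTheory.Rogawski1990
open Literature.NumberTheory.GaloisRepresentations Literature.NumberTheory.GaloisRepresentations.IsNonarchimedeanLocalField

namespace Summit.HodgeConjecture.HodgeConjecture.R90.S6

/-- **`log v_w χ_g(u)_w = log v_w(d₀,w) + 2 · log v_w((a − 1)_w)` ON THE WHOLE DIAGONAL TORUS** (`a = d₀⁻¹d₁`): from `χ_g(u) = (d₁ − d₀)(d₁ − d₂) =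
−d₀d₁(a − 1)σ(a − 1)` (★ `HeisRing.weylNumerator_eq`), `v_w(d₁,w) = 1` (torus relation `σ(d₁)d₁ = 1`, ★ `valued_finGammaTwo_apply_eq_one`) and
`v_w ∘ σ_w = v_w` — the integrality-free form of ★ `log_valued_eval_finCharpolyTwo_eq_two_mul` (there `ι_v(γ_H) ∈ K₃` kills the `d₀` term).
[cite: Rogawski1990, §4.9 p. 55] -/
theorem log_valued_weylNumerator_eq_of_diag (L : Type) [Field L] [NumberField L] [IsCMField L]
    {v : HeightOneSpectrum (𝓞 ↥(maximalRealSubfield L))} (w : PlacesOver L v) (hw : IsCMField.complexConj L • w.1 = w.1)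
    (γH : (cmDatum L 2 (Matrix.of fun i j : Fin 2 => if i.val + j.val + 1 = 2 then (1 : L) else 0)).Local v ×
      (cmDatum L 1 (Matrix.of fun i j : Fin 1 => if i.val + j.val + 1 = 1 then (1 : L) else 0)).Local v)
    {d : Fin 3 → (UnitaryGroup.LocalRing L v)ˣ}
    (hι : ((endoEmbLocal L v γH).val : GL (Fin 3) (UnitaryGroup.LocalRing L v)) = glDiagonal 3 (UnitaryGroup.LocalRing L v) d)
    (ha : IsUnit ((((d 0)⁻¹ * d 1 : (UnitaryGroup.LocalRing L v)ˣ) : UnitaryGroup.LocalRing L v) - 1)) :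
    WithZero.log (Valued.v (((finCharpolyTwo L v γH).eval (finGammaTwo L v γH)) w)) =
      WithZero.log (Valued.v ((d 0 : UnitaryGroup.LocalRing L v) w)) +
        2 * WithZero.log (Valued.v (((((d 0)⁻¹ * d 1 : (UnitaryGroup.LocalRing L v)ˣ) : UnitaryGroup.LocalRing L v) - 1) w)) := by
  have ht := endoEmbLocal_mem_torusU_of_endoEmbLocal_eq L v γH hι
  have h1 : Valued.v ((d 1 : UnitaryGroup.LocalRing L v) w) = 1 := by
    rw [← finGammaTwo_eq_of_endoEmbLocal_eq L v γH hι]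
    exact valued_finGammaTwo_apply_eq_one L v γH w hw
  rw [eval_finCharpolyTwo_eq_of_endoEmbLocal_eq L v γH hι,
    HeisRing.weylNumerator_eq (conjLocal L (IsCMField.complexConj L) v) (cmLocalForm_eq_over L 3 v) ⟨_, ht⟩ hι.symm]
  have hz : Valued.v (((((d 0)⁻¹ * d 1 : (UnitaryGroup.LocalRing L v)ˣ) : UnitaryGroup.LocalRing L v) - 1) w) ≠ 0 :=
    (Valuation.ne_zero_iff _).2 (Pi.isUnit_iff.1 ha w).ne_zero
  have h0 : Valued.v ((d 0 : UnitaryGroup.LocalRing L v) w) ≠ 0 :=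
    (Valuation.ne_zero_iff _).2 (Pi.isUnit_iff.1 (d 0).isUnit w).ne_zero
  rw [Pi.neg_apply, Valuation.map_neg, Pi.mul_apply, Pi.mul_apply, Pi.mul_apply, map_mul, map_mul, map_mul, h1, mul_one,
    conjLocal_apply_eq_galAdicCompletionMap L v w hw, valued_galAdicCompletionMap,
    WithZero.log_mul h0 (mul_ne_zero hz hz), WithZero.log_mul hz hz, two_mul]

end Summit.HodgeConjecture.HodgeConjecture.R90.S6

end
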